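import Summits.BirchSwinnertonDyer.BirchSwinnertonDyer.Theorems.EisensteinPrimesBSDpOnCellCTelescopeK2GlobalDefectFinite
import Summits.BirchSwinnertonDyer.BirchSwinnertonDyer.Theorems.EisensteinPrimesBSDpOnCellCTelescopeK2BigRepDivisible
import Summits.BirchSwinnertonDyer.BirchSwinnertonDyer.Theorems.EisensteinPrimesBSDpOnCellCTelescopeK2InertiaDefect
import Summits.BirchSwinnertonDyer.BirchSwinnertonDyer.Theorems.EisensteinPrimesBSDpOnCellCTelescopeK2WeightControl
import Summits.BirchSwinnertonDyer.BirchSwinnertonDyer.Theorems.EisensteinPrimesBSDpOnCellCTelescopeK2SelmerTorsionDefect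
import Summits.BirchSwinnertonDyer.BirchSwinnertonDyer.Theorems.EisensteinPrimesBSDpOnCellCTelescopeK2ControlTorsionDefect
import Literature.NumberTheory.EllipticCurves.BigGaloisRepLocalInputs
import HarnessLib

/-!
# Crux 4 `BSDpOnCellC` (stmt-BirchSwinnertonDyer-19034), line `telescope`, leaf N2 `stub_weightTwoControl` (W2) / N3: THE TWO-SIDED
# WEIGHT CONTROL OF `Sel^Σ_𝔮(K, M₂)`, `M₂ = A ⊗ Λ^*(Ψ⁻¹)`, AT `r = C c` WITH HYPOTHESES ON THE COEFFICIENT MODULE `A` ONLY —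
# finite global kernel and `C(d·p^a) • Sel(M₂)[C c] ⊆ θ(Sel(M₂[C c]))` (the tree's p737740 / p743708 composed with the seat's binder
# files p747667 / p747595 / p747781) (helper, `--supports stmt-BirchSwinnertonDyer-19034 --as helper`; closes nothing)

Cell `bsd-eis`, width seat `bsd-line-x2-p2` (prover g19, 2026-08-29; D-0154 KEY row 5). THEOREMS ONLY: no definition, no named
fact, no `sorry`, no instance, no notation. The assembly, BY NAME, of the tree's control theorems for the torsion sub-representation
`M₂[r] ↪ M₂` (`TelescopeK2WeightControl.finite_ker_torsionInclH1_of_finite_quot`, p737740, ideator bsd-idea-12 g34;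
`TelescopeK2SelmerTorsionDefect.smul_mem_map_torsionInclH1_selmer`, p743708, g36) with this seat's binders (`…GlobalDefectFinite`
p747667: `hglob` and the decomposition-type `hfin`; `…BigRepDivisible` p747595: `hr`; `…InertiaDefect` p747781: `hkill`), for
`ρM = AnticyclotomicBigGaloisRep κ ρ`, local maps `BigGaloisRep.localMap K`, constrained set `strictSet p 𝔮 Σ` (decomposition
condition at `𝔮`, inertia condition at every `w ∉ Σ`, `w ∤ p` — the Selmer structure of `XBig κ ρ 𝔮 Σ`), `r = C c`:

* **`finite_ker_torsionInclH1_of_coefficients`** — the GLOBAL side: `ker (H¹(Γ_K, M₂[C c]) → H¹(Γ_K, M₂))` is FINITE, from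
  (htor) «p-primary elements of `A` are `c`-power torsion», (hroot) «… and have p-primary `c`-th roots», (hfinK) «`{a ∈ A[c] :
  fixed by Gal(K̄/K_∞)}` finite»; `finite_ker_restrict_selmer_of_coefficients` — hence the control map restricted to
  `Sel(M₂[C c])` has finite kernel.
* **`smul_mem_map_torsionInclH1_selmer_of_coefficients`** — the COKERNEL side with torsion defect: `∃ a, ∀ y ∈ Sel(M₂)`,
  `(C c) • y = 0 → C (d * p^a) • y ∈ θ(Sel(M₂[C c]))`, from (hroot), (htor), the OPEN IMAGE of `κ` on `Γ_{K_𝔮}` (hsurj𝔮 —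
  tree `AnticyclotomicLocalImage.anticyclotomic_exists_forall_exists_toAdd_eq_pow_mul` for `κ` anticyclotomic, `𝔮 ∣ p`, `p` odd),
  (hfin𝔮) «`{a ∈ A[c] : fixed by Gal(K̄_𝔮/K_{∞,𝔮})}` finite» and (hinert) «at every inertia index `w` of the strict set, `d` kills
  the `c`-cotorsion of `A^{I_w}[p^∞]`» (vacuous — `d = 1` — where `A^{I_w}` is `c`-divisible, e.g. `ρ` unramified at `w`); the
  `ℤ_p`-extension is unramified at `w ∤ p` (tree `ZpExtension.apply_localMap_eq_one_of_inr_mem_strictSet`).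

* **`exists_quotSMulTop_XBig_linearMap_of_coefficients`** — the DUAL form = sub-leaf W2's conclusion shape: a `Λ_𝒪⟦T⟧`-linear
  `α : XBig κ ρ 𝔮 Σ ⧸ (C c) → Sel^Σ_𝔮(K, M₂[C c])^∨` with kernel killed by scalars prime to `C c` and FINITE cokernel, by the tree's
  dual algebra p743483 `exists_quotSMulTop_linearMap_torsionDefect_of_not_dvd` on the control map (given `c ∤ d·p^a`).

On Cell C at `c = X` the remaining inputs are arithmetic statements about `E` and the branch lattice: `E(K_∞)[p^∞]` and
`E(K_{∞,𝔭̄})[p^∞]` finite (via N1's (fd₀) and `TelescopeK2GlobalDefectInputs.finite_fixed_torsionBy_of_addMonoidHom`, p747415),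
and the inertia invariants of `A₂` at the ramified `w ∣ N` (the (G5-w) question of `Cruxes/BSDpOnCellC/W-PRICING-n2.md` rev 1.3).

HONEST FRAMING: assembly of tree theorems over binders; nothing about any curve, newform or branch lattice is asserted; BSD is proved
for no pair; no registered stub, crux or summit statement is proved by this file; closes: none.

References: [Castella2018Erratum] Lemma 2.1 (p. 2); [JetchevSkinnerWan2017] §3.4, Lemma 3.4.1 (arXiv:1512.06894 p. 14);
[Ochiai2006] Prop. 5.1 (Compositio 142 p. 1177); [GreenbergLNM1716] §4, proof of Prop. 4.10.
-/

noncomputable section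

-- D-0017: single-problem summit, the namespace repeats the problem name by design.
set_option linter.dupNamespace false
set_option autoImplicit false

open scoped Pointwise
open Field IsDedekindDomain NumberField
open Literature.NumberTheory.GaloisRepresentations Literature.NumberTheory.EllipticCurves
  Literature.NumberTheory.EllipticCurves.BigRepModule Literature.NumberTheory.EllipticCurves.BigGaloisRep
open Summit.BirchSwinnertonDyer.Rank1Residual.X11b

universe u

namespace Summit.BirchSwinnertonDyer.BirchSwinnertonDyer.Theorems.TelescopeK2ControlOfCoefficients

variable {K : Type u} [Field K] {p : ℕ} [Fact p.Prime]
  {𝒪 : Type*} [CommRing 𝒪] [TopologicalSpace 𝒪]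
  {A : Type u} [AddCommGroup A] [Module 𝒪 A] [TopologicalSpace A] [DiscreteTopology A]
  [TopologicalSpace (PowerSeries 𝒪)] [ContinuousSMul (PowerSeries 𝒪) (BigRepModule 𝒪 p A)]
  (κ : ZpExtension K p) (ρ : ContinuousRep (absoluteGaloisGroup K) 𝒪 A)

/-! ## §1 The global side: finite kernel -/

/-- **Finite global control defect from coefficient data**: `ker (H¹(Γ_K, M₂[C c]) → H¹(Γ_K, M₂))` is FINITE for
`M₂ = AnticyclotomicBigGaloisRep κ ρ`, from (htor), (hroot) and the finiteness of the `Gal(K̄/K_∞)`-fixed `c`-torsion of `A`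
(tree p737740 `finite_ker_torsionInclH1_of_finite_quot` ∘ p747595 `C_smul_surjective_of_primaryRoots` ∘ p747667
`finite_quotSMulTop_invariants_anticyclotomic`). [cite: Castella2018Erratum, Lemma 2.1 (p. 2)]
[cite: JetchevSkinnerWan2017, Lemma 3.4.1 (arXiv:1512.06894 p. 14)] -/
theorem finite_ker_torsionInclH1_of_coefficients (c : 𝒪)
    (htor : ∀ a : A, (∃ k : ℕ, p ^ k • a = 0) → ∃ n : ℕ, c ^ n • a = 0)
    (hroot : ∀ a : A, (∃ k : ℕ, p ^ k • a = 0) → ∃ b : A, (∃ k : ℕ, p ^ k • b = 0) ∧ c • b = a)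
    (hfinK : Set.Finite {a : A | c • a = 0 ∧ ∀ g : absoluteGaloisGroup K, κ g = 1 → ρ g a = a}) :
    Finite (LinearMap.ker (TorsionControl.torsionInclH1 (AnticyclotomicBigGaloisRep κ ρ)
      (PowerSeries.C c : PowerSeries 𝒪))) :=
  TelescopeK2WeightControl.finite_ker_torsionInclH1_of_finite_quot _ _
    (TelescopeK2BigRepDivisible.C_smul_surjective_of_primaryRoots c hroot)
    (TelescopeK2GlobalDefectFinite.finite_quotSMulTop_invariants_anticyclotomic κ ρ c htor hfinK)

/-- The same kernel restricted to the Selmer group `Sel_L(M₂[C c])` of ANY local data `(ψ, L)` is finite (it embeds in the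
previous one). [cite: JetchevSkinnerWan2017, Lemma 3.4.1 (arXiv:1512.06894 p. 14)] [folklore] -/
theorem finite_ker_restrict_selmer_of_coefficients (c : 𝒪)
    (htor : ∀ a : A, (∃ k : ℕ, p ^ k • a = 0) → ∃ n : ℕ, c ^ n • a = 0)
    (hroot : ∀ a : A, (∃ k : ℕ, p ^ k • a = 0) → ∃ b : A, (∃ k : ℕ, p ^ k • b = 0) ∧ c • b = a)
    (hfinK : Set.Finite {a : A | c • a = 0 ∧ ∀ g : absoluteGaloisGroup K, κ g = 1 → ρ g a = a})
    {ι : Type*} {Γv : ι → Type u} [∀ v, Group (Γv v)] [∀ v, TopologicalSpace (Γv v)]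
    [∀ v, IsTopologicalGroup (Γv v)] (ψ : ∀ v, Γv v →ₜ* absoluteGaloisGroup K) (L : Set ι) :
    Finite ↥(LinearMap.ker ((TorsionControl.torsionInclH1 (AnticyclotomicBigGaloisRep κ ρ)
        (PowerSeries.C c : PowerSeries 𝒪)).domRestrict
      (TorsionControl.selmer ψ L (TorsionControl.torsionRep (AnticyclotomicBigGaloisRep κ ρ)
        (PowerSeries.C c : PowerSeries 𝒪))))) := by
  haveI := finite_ker_torsionInclH1_of_coefficients κ ρ c htor hroot hfinK
  refine Finite.of_injective
    (fun x : LinearMap.ker ((TorsionControl.torsionInclH1 (AnticyclotomicBigGaloisRep κ ρ)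
        (PowerSeries.C c : PowerSeries 𝒪)).domRestrict
      (TorsionControl.selmer ψ L (TorsionControl.torsionRep (AnticyclotomicBigGaloisRep κ ρ)
        (PowerSeries.C c : PowerSeries 𝒪)))) =>
      (⟨(x.1 : continuousCohomology 1 (TorsionControl.torsionRep (AnticyclotomicBigGaloisRep κ ρ)
          (PowerSeries.C c : PowerSeries 𝒪)).toTopRep), by
        have hx := x.2
        rw [LinearMap.mem_ker, LinearMap.domRestrict_apply] at hx
        exact hx⟩ : LinearMap.ker (TorsionControl.torsionInclH1 (AnticyclotomicBigGaloisRep κ ρ)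
          (PowerSeries.C c : PowerSeries 𝒪)))) ?_
  intro x y hxy
  apply Subtype.ext
  apply Subtype.ext
  simpa using congrArg Subtype.val hxy

/-! ## §2 The cokernel side with torsion defect over `localMap K` / `strictSet p 𝔮 Σ` -/

section Local

variable [NumberField K]

/-- **`C(d · p^a) • Sel^Σ_𝔮(K, M₂)[C c] ⊆ θ(Sel^Σ_𝔮(K, M₂[C c]))` from coefficient data.** Hypotheses on `A` only: (htor),
(hroot); at the decomposition index `𝔮`: the open image `κ(Γ_{K_𝔮}) ⊇ p^s ℤ_p` (hsurj𝔮) and the finiteness of the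
`Gal(K̄_𝔮/K_{∞,𝔮})`-fixed `c`-torsion of `A` (hfin𝔮); at every inertia index `w` of the strict set: `d` kills the `c`-cotorsion of
`A^{I_w}[p^∞]` (hinert). Then ONE scalar `s = C (d * p^a)` (prime to `C X` when `d` is) satisfies
`s • y ∈ H¹(ι)(Sel(M₂[C c]))` for every `(C c)`-torsion Selmer class `y` — the hypothesis shape `hs` of the dual algebra
`TelescopeK2ControlTorsionDefect.exists_quotSMulTop_linearMap_torsionDefect` (p743483). Tree inputs by name: p743708
`smul_mem_map_torsionInclH1_selmer` (hr: p747595; hkill at `inl 𝔮`: p747667 `finite_quotSMulTop_invariants_restrict` + p747781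
`exists_C_pow_smul_mem_of_finite_quotSMulTop`; hkill at `inr w`: p747781 `exists_C_smul_eq_C_smul_invariants_restrict` with
`ZpExtension.apply_localMap_eq_one_of_inr_mem_strictSet`). [cite: Castella2018Erratum, Lemma 2.1 (p. 2)]
[cite: JetchevSkinnerWan2017, §3.4, Lemma 3.4.1 (arXiv:1512.06894 p. 14)] [cite: Ochiai2006, Prop. 5.1 (Compositio 142 p. 1177)] -/
theorem smul_mem_map_torsionInclH1_selmer_of_coefficients (𝔮 : HeightOneSpectrum (𝓞 K))
    (Sig : Set (HeightOneSpectrum (𝓞 K))) (c d : 𝒪)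
    (htor : ∀ a : A, (∃ k : ℕ, p ^ k • a = 0) → ∃ n : ℕ, c ^ n • a = 0)
    (hroot : ∀ a : A, (∃ k : ℕ, p ^ k • a = 0) → ∃ b : A, (∃ k : ℕ, p ^ k • b = 0) ∧ c • b = a)
    {s : ℕ} (hsurj𝔮 : ∀ y : ℤ_[p], ∃ τ : LocalGroup K (Sum.inl 𝔮),
      (κ (localMap K (Sum.inl 𝔮) τ)).toAdd = (p : ℤ_[p]) ^ s * y)
    (hfin𝔮 : Set.Finite {a : A | c • a = 0 ∧ ∀ τ : LocalGroup K (Sum.inl 𝔮),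
      κ (localMap K (Sum.inl 𝔮) τ) = 1 → ρ (localMap K (Sum.inl 𝔮) τ) a = a})
    (hinert : ∀ w : HeightOneSpectrum (𝓞 K), (Sum.inr w : LocalIndex K) ∈ strictSet p 𝔮 Sig →
      ∀ a : A, (∀ τ : LocalGroup K (Sum.inr w), ρ (localMap K (Sum.inr w) τ) a = a) → (∃ k : ℕ, p ^ k • a = 0) →
        ∃ b : A, (∀ τ : LocalGroup K (Sum.inr w), ρ (localMap K (Sum.inr w) τ) b = b) ∧
          (∃ k : ℕ, p ^ k • b = 0) ∧ c • b = d • a) :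
    ∃ a : ℕ, ∀ y : continuousCohomology 1 (AnticyclotomicBigGaloisRep κ ρ).toTopRep,
      y ∈ selmerBig κ ρ 𝔮 Sig → (PowerSeries.C c : PowerSeries 𝒪) • y = 0 →
        (PowerSeries.C (d * (p : 𝒪) ^ a) : PowerSeries 𝒪) • y ∈
          Submodule.map (TorsionControl.torsionInclH1 (AnticyclotomicBigGaloisRep κ ρ) (PowerSeries.C c : PowerSeries 𝒪))
            (TorsionControl.selmer (localMap K) (strictSet p 𝔮 Sig)
              (TorsionControl.torsionRep (AnticyclotomicBigGaloisRep κ ρ) (PowerSeries.C c : PowerSeries 𝒪))) := by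
  -- `hr`
  have hr := TelescopeK2BigRepDivisible.C_smul_surjective_of_primaryRoots (p := p) c hroot
  -- the decomposition index: finite cotorsion, killed by one `C (p^a)`
  haveI hfin := TelescopeK2GlobalDefectFinite.finite_quotSMulTop_invariants_restrict κ.toContinuousMonoidHom ρ c
    (localMap K (Sum.inl 𝔮)) hsurj𝔮 htor hfin𝔮
  obtain ⟨a, ha⟩ := TelescopeK2InertiaDefect.exists_C_pow_smul_mem_of_finite_quotSMulTop (p := p)
    (((AnticyclotomicBigGaloisRep κ ρ).restrict (localMap K (Sum.inl 𝔮))).toTopRep).ρ.invariants c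
  refine ⟨a, fun y hy hyc => ?_⟩
  refine TelescopeK2SelmerTorsionDefect.smul_mem_map_torsionInclH1_selmer (localMap K) (strictSet p 𝔮 Sig)
    (AnticyclotomicBigGaloisRep κ ρ) (PowerSeries.C c : PowerSeries 𝒪) (PowerSeries.C (d * (p : 𝒪) ^ a) : PowerSeries 𝒪)
    hr (fun v hv m hm => ?_) hy hyc
  -- `hkill` index by index
  rcases v with w | w
  · -- decomposition index: `w = 𝔮`
    obtain rfl : w = 𝔮 := (inl_mem_strictSet_iff p 𝔮 w Sig).1 hv
    obtain ⟨m', hm', h⟩ := ha m hm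
    refine ⟨(PowerSeries.C d : PowerSeries 𝒪) • m', Submodule.smul_mem _ _ hm', ?_⟩
    rw [smul_comm, h, ← mul_smul, ← map_mul, mul_comm]
  · -- inertia index: `κ ∘ localMap = 1`, roots in `A^{I_w}`
    have hκ : ∀ τ : LocalGroup K (Sum.inr w), κ.toContinuousMonoidHom (localMap K (Sum.inr w) τ) = 1 :=
      fun τ => ZpExtension.apply_localMap_eq_one_of_inr_mem_strictSet κ 𝔮 Sig hv τ
    obtain ⟨m', hm', h⟩ := TelescopeK2InertiaDefect.exists_C_smul_eq_C_smul_invariants_restrict (p := p)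
      κ.toContinuousMonoidHom ρ (localMap K (Sum.inr w)) hκ c d (hinert w hv) m hm
    refine ⟨(PowerSeries.C ((p : 𝒪) ^ a) : PowerSeries 𝒪) • m', Submodule.smul_mem _ _ hm', ?_⟩
    rw [smul_comm, h, ← mul_smul, ← map_mul, mul_comm]

/-! ## §3 The DUAL form: W2's conclusion shape `α : X₂/(C c)X₂ → Sel(M₂[C c])^∨` from coefficient data -/

omit [TopologicalSpace 𝒪] [TopologicalSpace (PowerSeries 𝒪)] in
/-- `C c ∣ C y` in `𝒪⟦T⟧` forces `c ∣ y` in `𝒪` (constant coefficients). [folklore] -/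
theorem dvd_of_C_dvd_C {c y : 𝒪} (h : (PowerSeries.C c : PowerSeries 𝒪) ∣ PowerSeries.C y) : c ∣ y := by
  obtain ⟨q, hq⟩ := h
  refine ⟨PowerSeries.constantCoeff q, ?_⟩
  have := congrArg PowerSeries.constantCoeff hq
  simpa only [map_mul, PowerSeries.constantCoeff_C] using this

/-- **W2's CONCLUSION SHAPE FROM COEFFICIENT DATA.** Under the hypotheses of §1–§2 and «`c ∤ d · p^a` for every `a`» (at `c = X`,
`d = p^b` in `ℤ_p⟦X⟧`: `X ∤ p^{a+b}`), there is a `Λ_𝒪⟦T⟧`-linear map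
`α : X^Σ_𝔮 ⧸ (C c) • X^Σ_𝔮 → Sel^Σ_𝔮(K, M₂[C c])^∨` (`X^Σ_𝔮 = XBig κ ρ 𝔮 Σ`) whose KERNEL is killed elementwise by scalars prime to `C c`
and whose COKERNEL is FINITE — the statement of sub-leaf W2 `stub_weightTwoControlMap` for `(κ, ρ, 𝔮, Σ, c)`, by the tree's dual
algebra `TelescopeK2ControlTorsionDefect.exists_quotSMulTop_linearMap_torsionDefect_of_not_dvd` (p743483) applied to the control
map `θ : Sel(M₂[C c]) → Sel(M₂)` (finite kernel §1; `C(d·p^a) • Sel(M₂)[C c] ⊆ range θ` §2; `(C c) • θ = 0`: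
`TorsionControl.smul_cohomologyMap_torsionIncl`). [cite: JetchevSkinnerWan2017, §3.4, Lemma 3.4.1 (arXiv:1512.06894 p. 14)]
[cite: Ochiai2006, Prop. 5.1 (Compositio 142 p. 1177)] [cite: Castella2018Erratum, Lemma 2.1 (p. 2)] -/
theorem exists_quotSMulTop_XBig_linearMap_of_coefficients (𝔮 : HeightOneSpectrum (𝓞 K))
    (Sig : Set (HeightOneSpectrum (𝓞 K))) (c d : 𝒪)
    (htor : ∀ a : A, (∃ k : ℕ, p ^ k • a = 0) → ∃ n : ℕ, c ^ n • a = 0)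
    (hroot : ∀ a : A, (∃ k : ℕ, p ^ k • a = 0) → ∃ b : A, (∃ k : ℕ, p ^ k • b = 0) ∧ c • b = a)
    (hfinK : Set.Finite {a : A | c • a = 0 ∧ ∀ g : absoluteGaloisGroup K, κ g = 1 → ρ g a = a})
    {s : ℕ} (hsurj𝔮 : ∀ y : ℤ_[p], ∃ τ : LocalGroup K (Sum.inl 𝔮),
      (κ (localMap K (Sum.inl 𝔮) τ)).toAdd = (p : ℤ_[p]) ^ s * y)
    (hfin𝔮 : Set.Finite {a : A | c • a = 0 ∧ ∀ τ : LocalGroup K (Sum.inl 𝔮),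
      κ (localMap K (Sum.inl 𝔮) τ) = 1 → ρ (localMap K (Sum.inl 𝔮) τ) a = a})
    (hinert : ∀ w : HeightOneSpectrum (𝓞 K), (Sum.inr w : LocalIndex K) ∈ strictSet p 𝔮 Sig →
      ∀ a : A, (∀ τ : LocalGroup K (Sum.inr w), ρ (localMap K (Sum.inr w) τ) a = a) → (∃ k : ℕ, p ^ k • a = 0) →
        ∃ b : A, (∀ τ : LocalGroup K (Sum.inr w), ρ (localMap K (Sum.inr w) τ) b = b) ∧
          (∃ k : ℕ, p ^ k • b = 0) ∧ c • b = d • a)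
    (hnd : ∀ a : ℕ, ¬ (c ∣ d * (p : 𝒪) ^ a)) :
    ∃ α : QuotSMulTop (PowerSeries.C c : PowerSeries 𝒪) (XBig κ ρ 𝔮 Sig) →ₗ[PowerSeries 𝒪]
        CharacterModule (TorsionControl.selmer (localMap K) (strictSet p 𝔮 Sig)
          (TorsionControl.torsionRep (AnticyclotomicBigGaloisRep κ ρ) (PowerSeries.C c : PowerSeries 𝒪))),
      (∀ m ∈ LinearMap.ker α, ∃ t : PowerSeries 𝒪, ¬ ((PowerSeries.C c : PowerSeries 𝒪) ∣ t) ∧ t • m = 0) ∧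
      Finite (CharacterModule (TorsionControl.selmer (localMap K) (strictSet p 𝔮 Sig)
          (TorsionControl.torsionRep (AnticyclotomicBigGaloisRep κ ρ) (PowerSeries.C c : PowerSeries 𝒪))) ⧸
        LinearMap.range α) := by
  obtain ⟨a, ha⟩ := smul_mem_map_torsionInclH1_selmer_of_coefficients κ ρ 𝔮 Sig c d htor hroot hsurj𝔮 hfin𝔮 hinert
  -- the control map `θ : Sel(M₂[C c]) → Sel(M₂) = selmerBig`
  have hmaps : ∀ x ∈ TorsionControl.selmer (localMap K) (strictSet p 𝔮 Sig)
      (TorsionControl.torsionRep (AnticyclotomicBigGaloisRep κ ρ) (PowerSeries.C c : PowerSeries 𝒪)),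
      TorsionControl.torsionInclH1 (AnticyclotomicBigGaloisRep κ ρ) (PowerSeries.C c : PowerSeries 𝒪) x ∈
        selmerBig κ ρ 𝔮 Sig :=
    fun x hx => TelescopeK2SelmerTorsionDefect.torsionInclH1_mem_selmer (localMap K) (strictSet p 𝔮 Sig)
      (AnticyclotomicBigGaloisRep κ ρ) (PowerSeries.C c : PowerSeries 𝒪) hx
  let θ := (TorsionControl.torsionInclH1 (AnticyclotomicBigGaloisRep κ ρ) (PowerSeries.C c : PowerSeries 𝒪)).restrict hmaps
  -- `(C c) • θ = 0`
  have hθr : ∀ n, (PowerSeries.C c : PowerSeries 𝒪) • θ n = 0 := fun n => by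
    apply Subtype.ext
    change (PowerSeries.C c : PowerSeries 𝒪) •
      TorsionControl.torsionInclH1 (AnticyclotomicBigGaloisRep κ ρ) (PowerSeries.C c : PowerSeries 𝒪)
        (n : continuousCohomology 1 (TorsionControl.torsionRep (AnticyclotomicBigGaloisRep κ ρ)
          (PowerSeries.C c : PowerSeries 𝒪)).toTopRep) = 0
    rw [TorsionControl.torsionInclH1_apply]
    exact TorsionControl.smul_cohomologyMap_torsionIncl _ _ _
  -- finite kernel
  have hker : Finite (LinearMap.ker θ) := by
    haveI := finite_ker_torsionInclH1_of_coefficients κ ρ c htor hroot hfinK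
    rw [LinearMap.ker_restrict]
    refine Finite.of_injective (fun x : Submodule.comap (Submodule.subtype _)
        (LinearMap.ker (TorsionControl.torsionInclH1 (AnticyclotomicBigGaloisRep κ ρ) (PowerSeries.C c : PowerSeries 𝒪))) =>
      (⟨((x : TorsionControl.selmer (localMap K) (strictSet p 𝔮 Sig)
          (TorsionControl.torsionRep (AnticyclotomicBigGaloisRep κ ρ) (PowerSeries.C c : PowerSeries 𝒪))) :
            continuousCohomology 1 (TorsionControl.torsionRep (AnticyclotomicBigGaloisRep κ ρ)
              (PowerSeries.C c : PowerSeries 𝒪)).toTopRep), x.2⟩ :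
        LinearMap.ker (TorsionControl.torsionInclH1 (AnticyclotomicBigGaloisRep κ ρ) (PowerSeries.C c : PowerSeries 𝒪)))) ?_
    intro x y hxy
    apply Subtype.ext
    apply Subtype.ext
    exact congrArg (fun z : LinearMap.ker (TorsionControl.torsionInclH1 (AnticyclotomicBigGaloisRep κ ρ)
      (PowerSeries.C c : PowerSeries 𝒪)) => (z : continuousCohomology 1 (TorsionControl.torsionRep
        (AnticyclotomicBigGaloisRep κ ρ) (PowerSeries.C c : PowerSeries 𝒪)).toTopRep)) hxy
  -- `C(d·p^a) • Sel(M₂)[C c] ⊆ range θ`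
  have hs : ∀ y : selmerBig κ ρ 𝔮 Sig, (PowerSeries.C c : PowerSeries 𝒪) • y = 0 →
      (PowerSeries.C (d * (p : 𝒪) ^ a) : PowerSeries 𝒪) • y ∈ LinearMap.range θ := by
    intro y hyc
    have hyc' : (PowerSeries.C c : PowerSeries 𝒪) • (y : continuousCohomology 1 (AnticyclotomicBigGaloisRep κ ρ).toTopRep) = 0 := by
      rw [← Submodule.coe_smul, hyc, Submodule.coe_zero]
    obtain ⟨x, hxS, hxy⟩ := Submodule.mem_map.1 (ha y y.2 hyc')
    refine ⟨⟨x, hxS⟩, Subtype.ext ?_⟩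
    rw [LinearMap.restrict_apply, Submodule.coe_smul]
    exact hxy
  have hrs : ¬ ((PowerSeries.C c : PowerSeries 𝒪) ∣ PowerSeries.C (d * (p : 𝒪) ^ a)) := fun h => hnd a (dvd_of_C_dvd_C h)
  obtain ⟨f, -, hkerf, hcok⟩ :=
    TelescopeK2ControlTorsionDefect.exists_quotSMulTop_linearMap_torsionDefect_of_not_dvd
      (PowerSeries.C c : PowerSeries 𝒪) (PowerSeries.C (d * (p : 𝒪) ^ a) : PowerSeries 𝒪) θ hθr hker hs hrs
  exact ⟨f, hkerf, hcok⟩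

end Local

end Summit.BirchSwinnertonDyer.BirchSwinnertonDyer.Theorems.TelescopeK2ControlOfCoefficients

end
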